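import Literature.MathematicalPhysics.QuantumFieldTheory.Balaban1983to89.B9Ineq385VG
import Literature.MathematicalPhysics.QuantumFieldTheory.Balaban1983to89.B6RandomWalkHom

/-!
# `Balaban1983to89.B9Ineq386RightEntry` — B9 p. 407 (3.86): the RIGHT entry (3.42)₃ `G(U′U)∇*_U` of Theorem 3.3 for
# `G(U′U)`, in the block-majorant (operator) form of [4] (2.51), from the LEFT resolvent form of (3.86), the entry (3.42)₃ for
# `G(U)` and a divergence-form reading of `V(A)` — no Hölder entry

HONEST FRAMING (cell `lit-balaban`, verbatim): statement-level skeleton of published theorems with citation tags; proofs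
where landed; nothing here is a claim about the Yang–Mills mass gap.

DOCFIX (cell `lit-balaban`, seat r06 gen 15, 2026-08-22; p37 `CITELOC-SWEEP-B4B9.md` §2b page-numeral slips, text layer re-read): (3.70) is p. 404 [PDF 16] ((3.71)–(3.73) p. 405) — the locators of (3.70)–(3.73) in this file corrected accordingly (1 place(s)); declarations, statements and proofs byte-identical to the tree copy of record (p255947).
DOCFIX 2 (r06 gen 16, 2026-08-22, DOC-ONLY; summit-lit1 g79 CITELOC KNOWN-ROWED slip `:482`): (3.74)–(3.76) are p. 405 [PDF 17], (3.77) p. 406 — the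
CITATION HEADER and the §5 locators corrected (3 places); declarations, statements and proofs byte-identical to the tree copy.
DOCFIX 3 (r06 gen 21, 2026-08-23, DOC-ONLY; typer g28 `QUOTE-AUDIT-FLEET-DELTA.md`): the p. 398 remark on the powers Lʲη stood PARAPHRASED inside
guillemets in this header and in the `ScaleTransfer` paragraph of §2 (a (Lʲη)(L^{j′}η)⁻¹ ≦ (RM)^{|j−j′|} sentence found in no text layer of CMP 99 or
CMP 96); both now carry the printed sentence (PDF p. 10 L20–24, re-read by this seat 2026-08-23) with the mechanism stated unquoted; no declaration,
statement or proof touched.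

CITATION HEADER (lean-in-tree rule).  T. Bałaban, *Propagators for lattice gauge theories in a background field*, Commun.
Math. Phys. **99** (1985) 389–434 [`Balaban1985BackgroundPropagators`] (cell paper B9; journal page = PDF page + 388):
p. 407 [PDF 19] (3.84)–(3.86) and the closing sentences of Sect. B; pp. 404–405 [PDF 16–17] (3.70)–(3.73); p. 405
(3.74)–(3.76), p. 406 [PDF 18] (3.77); p. 399 [PDF 11] Theorem 3.3; p. 397–398 [PDF 9–10] (3.42) and the remarks after Theorem 3.1; p. 402–403
[PDF 14–15] (3.60)–(3.65); [4] = T. Bałaban, *Propagators and renormalization transformations for lattice gauge theories. II*,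
Commun. Math. Phys. **96** (1984) 223–250 [`Balaban1984PropagatorsII`], (2.51)–(2.55) p. 232, Lemma 2.1 p. 234, Prop. 2.2
(2.64)–(2.66) p. 234.  Text read from the held text layer (`lit read paper:balaban1985-cmp99-background-propagators --pages
17-19`) and the renders `b2b-balaban-ref1/pages/1985-cmp99-background-propagators/…-p009/p010/p014/p015/p017/p018-x2.png`
READ AS IMAGES by this seat (2026-08-21).  Cell `lit-balaban` seat r06 gen 7 (B9 fold owner), SKELETON row `B9.Eq3.85`
(«(3.86) ⇒ (3.42) for G(U′U)»: entries 1, 2, 4 in `B9Ineq385VG` §4–§5; entry 3 was «NOT here (Hölder zone)»).  Continuation of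
`B9Ineq385VG` (same seat, same session) and of pv21's `B6RandomWalkHom` (j)–(l) (the `G′(U′U)` model of the all-left route:
`b9_rightEntry_of_365`, `b9_rightEntry_outputWeight_365`, USED BY NAME).

WHAT IS PRINTED («…» verbatim).  p. 407: «and we have G(U′U) = G(U)(I − V(A)G(U))⁻¹ = Σ_{n=0}^∞ G(U)(V(A)G(U))ⁿ, (3.86) …
Theorem (3.3) implies also convergence in all norms appearing in its formulation, thus in all norms on the left-hand sides
of the inequalities (3.42)–(3.47). This way we get all these inequalities for the operator G(U′U), the local ones follow
from the bound (3.85) and Lemma 2.1 [4].»  p. 397 (3.42): «|(G′(U)λ)(x)|, |(∇_UG′(U)λ)(x)|, |(G′(U)∇*_Uλ)(x)|, |(Δ_UG′(U)λ)(x)|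
≦ B₀[(Lʲη)², Lʲη, Lʲη, 1]e^{−δ₀d(y,y′)}|λ| for x ∈ B(y), y ∈ Λ_j, supp λ ⊂ Δ(y′)» (fourth entry: print defect T1, `Δ_U`).
p. 398 (remarks after Theorem 3.1, PDF p. 10 L20–24): «Next, the choice of powers Lʲη is conventional also. Using Lemma 2.1 in
[4] we may replace the factor (Lʲη)^α by (Lʲη)^β(L^{j′}η)^γ with β + γ = α, j, j′ are indices of localizations» — mechanism (ours,
NOT a quotation): the ratio of the two block scales (Lʲη)(L^{j′}η)⁻¹ is absorbed by the weight e^{−αδ₀d(y,y′)} at the price of the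
rate ([4] Lemma 2.1, (2.60)–(2.61) p. 234) —, «we may always replace ∇_U by ∇*_U».  p. 405 (3.73): «|(V₁(A)A′)(b)| ≦ O(1)(|A||∇A′| + |∇A||A′| + |A|²|A′|) ≦ O(1)α₁((Lʲη)⁻¹|∇A′| + (Lʲη)⁻²|A′|),
b ∈ Ω_j»; (3.70)–(3.71) and (3.74)–(3.75) display `V₁(A)`, `V₂(A)` as sums of commutator terms `[−iadA_μ(x), ·]` applied
to transported first covariant differences of `A′` and of terms in `ad(D_μA_ν)(x)` applied to transported values of `A′`,
minus the local remainders `F_{1,k}(A)`, `F_{2,k}(A)` ((3.72)).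

WHAT THIS FILE PROVES (theorems only; no definitions, no `Prop` placeholders, 0 new facts; standard axioms).  SETTING as in
`B9Ineq385VG`: pv08's `B6RandomWalk.HasMajorant` over `B9Thm34Ext.toB6`, all letters in ONE `Module.End ℝ (W → ℝ)` with
block map `blk : W → 𝔅`; `Ds` = the letter `∇*_U` (so that (3.42)₃ is the majorant of the PRODUCT `G·Ds`).
* §1 `transfer_of_scaleTransfer` — the p. 398 convention `ScaleTransfer g δ₀ α Λ P` read, with the symmetry of `d`, as the
  two-sided weight inequality `P(y) ≦ ΛP(y′)e^{αδ₀d(y,y′)}` that pv21's right-entry theorems consume.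
* §2 **`gExt_rightEntry_inputWeight_of_386L`**, **`gExt_rightEntry_of_386L`** — (3.86), LEFT resolvent form `G(U′U) = G(U)
  + G(U)V(A)G(U′U)` (the first equality of (3.86) expanded from the left; on the finite lattice both forms hold for the
  two-sided inverse, `B9Ineq385VG.exists_gExt_of_385`), multiplied on the right by `∇*_U`: the fixed point `G(U′U)∇* =
  G(U)∇* + (G(U)V(A))·(G(U′U)∇*)`.  From (3.42)₃ for `G(U)` (`G(U)∇* ≺ B₀P(y)e^{−ρd}`), a majorant `G(U)V(A) ≺ θe^{−ρd}` of
  the LEFT composite, Lemma 2.1 of [4] at `(ρ, α′)`, the convention at `(ρ, α′)` with constant `Λ` and the located smallness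
  `θc₁(α′) < 1`: `G(U′U)∇* ≺ B₀Λc₁(α′)(1 − θc₁(α′))⁻¹P(y′)e^{−(1−2α′)ρd}` (powers at the INPUT block, [4] Prop. 2.2) and
  `≺ B₀Λ²c₁(α′)(1 − θc₁(α′))⁻¹P(y)e^{−(1−3α′)ρd}` (powers at the output block, one more use of the convention) — instances of
  pv21's `B6RandomWalkHom.b9_rightEntry_of_365` / `b9_rightEntry_outputWeight_365` (the `G′(U′U)` twins) with trivial
  output weight; `gExt_rightEntry_explicit` — Theorem 3.4's threshold form: `θ = κ₀B₀α₁`, `α₁ ≦ (2κ₀B₀c₁(α′))⁻¹` ⟹ constant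
  `2B₀Λ²c₁(α′)`.
* §3 **`hasMajorant_GV_of_divForm`** — the LEFT composite from printed-TYPE inputs: with `V(A) = B9Eq386Neumann.vTotal V₃ P₁
  P₂` ((3.84)), `V₃` READ IN DIVERGENCE FORM `V₃ = ∇♯·B₃ + C₃` (`∇♯` a first-difference letter carrying the (3.42)₃ entry
  `G(U)∇♯ ≺ B₀Lʲη e^{−δd}` — «we may always replace ∇_U by ∇*_U» —, `B₃ ≺ c_Vα₁(Lʲη)⁻¹e^{−δd}`, `C₃ ≺ c_Vα₁(Lʲη)⁻²e^{−δd}`: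
  the (3.73) SIZES with the derivative handed to the left), `P₁ ≺ κ₁α₁(Lʲη)⁻²e^{−δd}` ((3.77)), `P₂ ≺ κ₂α₁(Lʲη)⁻²e^{−δd}`
  ((3.83)), `G(U) ≺ B₀(Lʲη)²e^{−δd}` ((3.42)₁) and the scale transfers of `(Lʲη)⁻¹`, `(Lʲη)⁻²`: **`G(U)V(A) ≺ κ₃₈₅·α₁·
  e^{−ρd}`**, `ρ + (α+β)δ₀ ≦ δ`, with THE SAME constant `κ₃₈₅ = B₀Λc(2c_V + κ₁ + κ₂)` as (3.85) (`B9Ineq385VG.kappa385`).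
* §4 **`gExt_entry3_of_385div_386L`** (entry 3 for `G(U′U)` from the §3 letters and the left resolvent identity) and
  **`thm34_G_entries13_opForm`** — Theorem 3.4's `G`-part, entries (3.42)₁ AND (3.42)₃ for ONE AND THE SAME operator
  `G(U′U)`, with no hypothesis on `G(U′U)`: the hypotheses of `B9Ineq385VG.thm34_G_entry1_opForm` (gradient-form reading of
  `V₃` for (3.85), existence and entry 1) plus the divergence-form letters of §3, (3.42)₃ for `G(U)` and the convention at
  `(ρ, α′)` give ∃ `G(U′U)`, the two-sided inverse of `Δ_a(U′U) = B9Eq386Neumann.deltaA DsD′ Δp′ DRDs′ Qs′ a Q′`, with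
  `G(U′U) ≺ B₀c₁(1 − κ₃₈₅α₁c₁)⁻¹(Lʲη)²e^{−(1−α′)ρd}` and `G(U′U)∇* ≺ B₀Λ_ρ²c₁(1 − κ₃₈₅α₁c₁)⁻¹Lʲη e^{−(1−3α′)ρd}`
  (`c₁ = c₁(ρ, α′)`, one smallness condition `κ₃₈₅α₁c₁ < 1` for both entries).
* §5 (v1.1, append-only) **the divergence-form letters FROM the gradient form (3.73) and ONE commutator letter** —
  `divForm_of_gradForm` (ring identity `V⁰ + V¹∇ = ∇V¹ + (V⁰ + (V¹∇ − ∇V¹))`), `hasMajorant_C₃_of_comm`,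
  **`hasMajorant_GV_of_gradForm_comm`** and **`thm34_G_entries13_opForm_of_comm`**: the four divergence-form hypotheses
  `hV₃div`/`hB₃`/`hC₃`/`hGDv` of §3–§4 are DISCHARGED from the gradient-form reading `V₃ = V⁰ + V¹∇` already used for (3.85)
  (`B9Ineq385VG.ineq385_op`, hypotheses `hV0`/`hV1`), the entry `G(U)∇ ≺ B₀Lʲη e^{−δd}` («we may always replace ∇_U by
  ∇*_U», p. 398) and ONE located letter, the commutator `[V¹, ∇] = V¹∇ − ∇V¹ ≺ c_Kα₁(Lʲη)⁻²e^{−δd}` — in print the covariant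
  difference of the coefficients `adA_μ(x)R(U(x,·))` of (3.70)/(3.74), of size `|∇^η_UA| < α₁(Lʲη)⁻²` by the domain
  condition (3.37) (lattice Leibniz rule; not displayed).  Constants: `κ₃₈₅` with `c_V + c_K` in place of `c_V`, one
  smallness condition `κ₃₈₅(c_V + c_K)α₁c₁ < 1`; with `c_K = 0` (a `V¹` commuting with `∇`) §4 is recovered verbatim.

SCOPE / NOT CLAIMED.  (i) OPERATOR (block `L^∞ → L^∞`) FORM throughout, as in `B9Ineq385VG` (i).  (ii) THE DIVERGENCE
FORM OF `V₃` IS A READING, NOT A DISPLAY: (3.70)–(3.71)/(3.74)–(3.75) print `V₁(A)`, `V₂(A)` as first-order covariant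
difference operators with coefficients `adA`, `ad(DA)` and the local remainders `F_{1,k}`, `F_{2,k}`; the print bounds them
in GRADIENT form (3.73) (derivative on the argument), which serves the left entries ((3.85), `B9Ineq385VG`); moving the
difference onto the left factor (lattice Leibniz rule, the coefficient differences bounded through (3.37) `|∇^η_UA′| <
α₁(Lʲη)⁻²`) is the same undisplayed step as for `V′(A)` of (3.60) (cell GAPS G-pv21g2-2, pv21's `B6RandomWalkHom` (j)–(l);
used for (3.68)₃,₄ in `B9Ineq368PPrimeDs`) and enters HERE AS THE HYPOTHESES `hV₃div`, `hB₃`, `hC₃`, `hGDv` — nothing about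
`V₃` itself is asserted.  With the gradient form the right-routed chain would contain the mixed kernel `∇_UG(U)∇*_U`, for
which only the Hölder bound (3.44) («B′₀(ε) → ∞ if ε → 0») is in print (cell GAPS G-B9-02): the present file shows that the
right sup-entry (3.42)₃ of `G(U′U)` does NOT need it, granted the divergence-form reading.  (iii) Rates and weights: `ρ` any
rate with the stated margin below the common input rate `δ`; §2 loses `2α′ρ` (input-weight form) or `3α′ρ` (output-weight
form) as pv21's (j) does, the convention being invoked at the rate in use (`hTρ : ScaleTransfer g ρ α′ Λ_ρ (Lʲη)`, a
separate hypothesis from the `δ₀`-based transfers of §3).  (iv) NOT here: the Hölder / L² / global entries (3.43)–(3.47) for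
`G(U′U)`, the pointwise `(L^{j′}η)^{−d}` kernel forms, analyticity ((3.86) «Each term … analytic» = NE9 seat's
`B9Eq386NeumannAnalytic`), the identification of the divergence form on a concrete carrier.  Value = the right sup-entry of
«This way we get all these inequalities for the operator G(U′U)» kernel-checked in operator form with constants, NOT summit
progress.

RELATED IN THE TREE, NOT DUPLICATED (searched 2026-08-21: `ls Balaban1983to89/ | grep -i '386\|RightEntry\|342'` =
`B9Eq386Neumann`, `B9Eq386NeumannAnalytic` only; `lean search 'rightEntry'` = pv21's `B6RandomWalkHom.b9_rightEntry_of_365`,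
`b9_rightEntry_outputWeight_365`, `b9_rightEntry_of_365_divForm` — the `G′(U′U)` statements over two function spaces with
the (3.61)-type column-sum hypotheses, USED BY NAME here in the one-space dressed-majorant vocabulary of `B9Ineq385VG`):
`B9Ineq385VG` (entries 1, 2, 4 and existence), `B9Ineq368PPrimeDs.hasMajorant_GVEDs` (the same divergence-form mechanism
inside the word `G′V′G′(U′U)D*` of (3.68)), `B9Thm34Ext` ((3.65) for `G′`, left entries), `B9.SectBStepPrinted` (by-reference
leaf, untouched).  None states (3.42)₃ for `G(U′U)`.
-/

noncomputable section

namespace Literature.MathematicalPhysics.QuantumFieldTheory.Balaban1983to89.B9Ineq386RightEntry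

open Literature.MathematicalPhysics.QuantumFieldTheory.Balaban1983to89
open Literature.MathematicalPhysics.QuantumFieldTheory.Balaban1983to89.B6RandomWalk (HasMajorant BlockSupp
  hasMajorant_mono hasMajorant_mul hasMajorant_add Triangle254 Ineq261 Ineq263)
open Literature.MathematicalPhysics.QuantumFieldTheory.Balaban1983to89.B6RandomWalkHom (HasMajorantHom hasMajorantHom_iff
  hasMajorantHom_mono)
open Literature.MathematicalPhysics.QuantumFieldTheory.Balaban1983to89.B9Thm34Ext (toB6)
open Literature.MathematicalPhysics.QuantumFieldTheory.Balaban1983to89.B9Ineq347 (ScaleTransfer)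
open Literature.MathematicalPhysics.QuantumFieldTheory.Balaban1983to89.B9Ineq366CPrime (hasMajorant_comp_decay
  hasMajorant_rate_mono)
open Literature.MathematicalPhysics.QuantumFieldTheory.Balaban1983to89.B9Eq386Neumann (pTwo vTotal)
open Literature.MathematicalPhysics.QuantumFieldTheory.Balaban1983to89.B9Ineq385VG (kappa385 kappa385_nonneg ineq385_op
  gExt_entry1_of_386)

/-! ## §1  The p. 398 convention as the two-sided weight inequality -/

section Transfer

variable {g : B9.Geometry}

/-- **p. 398, remarks after Theorem 3.1** («the choice of powers Lʲη is conventional also. Using Lemma 2.1 in [4] we may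
replace the factor (Lʲη)^α by (Lʲη)^β(L^{j′}η)^γ with β + γ = α»; mechanism, not printed in these words: the ratio of the two
block scales is absorbed by the exponential weight at the price of the rate): the scale transfer `ScaleTransfer g δ₀ α Λ P` (`e^{−αδ₀d(y,y′)}P(y′) ≦
ΛP(y)`), read with the symmetry of `d`, is the weight inequality `P(y) ≦ Λ·P(y′)·e^{αδ₀d(y,y′)}` in the shape consumed by
pv21's `B6RandomWalkHom.b9_rightEntry_of_365` (`htransfer`).
[cite: Balaban1985BackgroundPropagators, p.398 (remarks after Thm 3.1); Balaban1984PropagatorsII, (2.60) p.234] -/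
theorem transfer_of_scaleTransfer {δ₀ α Λ : ℝ} {P : g.Site → ℝ}
    (hsym : ∀ y y' : g.Site, g.dist y y' = g.dist y' y) (hT : ScaleTransfer g δ₀ α Λ P) (a b : g.Site) :
    P a ≤ Λ * P b * Real.exp (α * δ₀ * g.dist a b) := by
  have h := hT b a
  rw [hsym b a] at h
  have hE : 0 < Real.exp (α * δ₀ * g.dist a b) := Real.exp_pos _
  calc P a = Real.exp (-(α * δ₀ * g.dist a b)) * P a * Real.exp (α * δ₀ * g.dist a b) := by
        rw [mul_comm (Real.exp _) (P a), mul_assoc, ← Real.exp_add, neg_add_cancel, Real.exp_zero, mul_one]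
    _ ≤ Λ * P b * Real.exp (α * δ₀ * g.dist a b) := mul_le_mul_of_nonneg_right h hE.le

end Transfer

/-! ## §2  (3.86), left resolvent form, multiplied on the right by `∇*_U`: the right entry (3.42)₃ for `G(U′U)` -/

section RightEntry

variable {g : B9.Geometry} [Fintype g.Site] {R : ℝ} {H : Prop} {W : Type} [Fintype W] [DecidableEq W]

/-- **(3.86) ⇒ (3.42)₃ for `G(U′U)`, powers at the input block** ([4] Prop. 2.2 shape).  From the LEFT resolvent form
`G(U′U) = G(U) + G(U)V(A)G(U′U)` of (3.86) (`h386L`), the fixed point `G(U′U)∇* = G(U)∇* + (G(U)V(A))(G(U′U)∇*)`; Theorem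
3.3's (3.42)₃ for `G(U)` (`h342R : G(U)∇* ≺ B₀P(y)e^{−ρd}`), a majorant `G(U)V(A) ≺ θe^{−ρd}` of the left composite (`hGV`;
§3 derives it), Lemma 2.1 of [4] at `(ρ, α′)`, (2.54), the symmetry of `d`, the p. 398 convention at `(ρ, α′)` with
constant `Λ` (`hTρ`) and the located smallness `θc₁(α′) < 1` give `G(U′U)∇* ≺ B₀Λc₁(α′)(1 − θc₁(α′))⁻¹·P(y′)·
e^{−(1−2α′)ρd(y,y′)}`.  Instance of pv21's `B6RandomWalkHom.b9_rightEntry_of_365` (the `G′(U′U)` twin, two function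
spaces) with trivial output weight, read back through `hasMajorantHom_iff`.
[cite: Balaban1985BackgroundPropagators, (3.86) p.407 + (3.42) p.397 + p.398 (remarks) + Thm 3.3 p.399; Balaban1984PropagatorsII, Prop. 2.2 (2.64)–(2.66) p.234 + Lemma 2.1 p.234] -/
theorem gExt_rightEntry_inputWeight_of_386L (blk : W → g.Site) (d : ℕ) (ρ α' θ B₀ Λ : ℝ) (P : g.Site → ℝ)
    (hB₀ : 0 ≤ B₀) (hΛ : 0 ≤ Λ) (hP : ∀ y, 0 ≤ P y) (hθ : 0 ≤ θ) (hρ : 0 ≤ ρ) (hα' : α' ≤ 1) (hα'ρ : 0 ≤ α' * ρ)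
    (hα'ρ2 : 0 ≤ (1 - 2 * α') * ρ)
    (htri : Triangle254 (toB6 g R H)) (hrefl : ∀ y : g.Site, g.dist y y = 0)
    (hsym : ∀ y y' : g.Site, g.dist y y' = g.dist y' y) (hdnn : ∀ y y' : g.Site, 0 ≤ g.dist y y')
    (h261 : Ineq261 d (toB6 g R H) ρ α') (hsmall : θ * B6.c1 d ρ α' < 1) (hTρ : ScaleTransfer g ρ α' Λ P)
    {GU GExt V Ds : Module.End ℝ (W → ℝ)}
    (h342R : HasMajorant (g := toB6 g R H) blk (GU * Ds) (fun a b => B₀ * P a * Real.exp (-(ρ * g.dist a b))))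
    (hGV : HasMajorant (g := toB6 g R H) blk (GU * V) (fun a b => θ * Real.exp (-(ρ * g.dist a b))))
    (h386L : GExt = GU + GU * V * GExt) :
    HasMajorant (g := toB6 g R H) blk (GExt * Ds)
      (fun a b => B₀ * Λ * B6.c1 d ρ α' * (1 - θ * B6.c1 d ρ α')⁻¹ * P b *
        Real.exp (-((1 - 2 * α') * ρ * g.dist a b))) := by
  have h263 := B9Thm34Ext.h263_of_h261 g R H d ρ α' htri hρ hα' h261
  have htransfer : ∀ a b : g.Site, P a ≤ Λ * P b * Real.exp (α' * ρ * g.dist a b) :=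
    transfer_of_scaleTransfer hsym hTρ
  have h342D : HasMajorantHom (g := toB6 g R H) blk blk (GU * Ds)
      (fun a b => B₀ * (fun _ : g.Site => (1 : ℝ)) a * P a * Real.exp (-(ρ * g.dist a b))) :=
    hasMajorantHom_mono (g := toB6 g R H) blk blk ((hasMajorantHom_iff (g := toB6 g R H) blk (GU * Ds) _).2 h342R)
      fun a b => by simp
  have hGV' : HasMajorant (g := toB6 g R H) blk (GU * V)
      (fun a b => θ * (fun _ : g.Site => (1 : ℝ)) a * ((fun _ : g.Site => (1 : ℝ)) b)⁻¹ *
        Real.exp (-(ρ * g.dist a b))) :=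
    hasMajorant_mono (g := toB6 g R H) blk hGV fun a b => by simp
  have key := B6RandomWalkHom.b9_rightEntry_of_365 (R := R) (H := H) blk blk d ρ α' θ B₀ Λ (fun _ => (1 : ℝ)) P hB₀
    hΛ (fun _ => one_pos) hP hθ hα'ρ hα'ρ2 htri hrefl hsym hdnn h261 h263 hsmall htransfer h342D hGV' h386L
  refine hasMajorant_mono (g := toB6 g R H) blk ((hasMajorantHom_iff (g := toB6 g R H) blk (GExt * Ds) _).1 key)
    fun a b => le_of_eq ?_
  simp

/-- **(3.86) ⇒ (3.42)₃ for `G(U′U)`, powers at the output block as printed** («|(G(U′U)∇*_Uλ)(x)| ≦ B₀Lʲη e^{−δ₀d(y,y′)}|λ|»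
shape): one more use of the convention turns `P(y′)` into `P(y)` at the cost of a third `α′`: `G(U′U)∇* ≺ B₀Λ²c₁(α′)(1 −
θc₁(α′))⁻¹·P(y)·e^{−(1−3α′)ρd(y,y′)}`.  Instance of pv21's `B6RandomWalkHom.b9_rightEntry_outputWeight_365`.
[cite: Balaban1985BackgroundPropagators, (3.86) p.407 + (3.42)₃ p.397 + p.398 (remarks); Balaban1984PropagatorsII, (2.66) p.234] -/
theorem gExt_rightEntry_of_386L (blk : W → g.Site) (d : ℕ) (ρ α' θ B₀ Λ : ℝ) (P : g.Site → ℝ)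
    (hB₀ : 0 ≤ B₀) (hΛ : 0 ≤ Λ) (hP : ∀ y, 0 ≤ P y) (hθ : 0 ≤ θ) (hρ : 0 ≤ ρ) (hα' : α' ≤ 1) (hα'ρ : 0 ≤ α' * ρ)
    (hα'ρ2 : 0 ≤ (1 - 2 * α') * ρ)
    (htri : Triangle254 (toB6 g R H)) (hrefl : ∀ y : g.Site, g.dist y y = 0)
    (hsym : ∀ y y' : g.Site, g.dist y y' = g.dist y' y) (hdnn : ∀ y y' : g.Site, 0 ≤ g.dist y y')
    (h261 : Ineq261 d (toB6 g R H) ρ α') (hsmall : θ * B6.c1 d ρ α' < 1) (hTρ : ScaleTransfer g ρ α' Λ P)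
    {GU GExt V Ds : Module.End ℝ (W → ℝ)}
    (h342R : HasMajorant (g := toB6 g R H) blk (GU * Ds) (fun a b => B₀ * P a * Real.exp (-(ρ * g.dist a b))))
    (hGV : HasMajorant (g := toB6 g R H) blk (GU * V) (fun a b => θ * Real.exp (-(ρ * g.dist a b))))
    (h386L : GExt = GU + GU * V * GExt) :
    HasMajorant (g := toB6 g R H) blk (GExt * Ds)
      (fun a b => B₀ * Λ ^ 2 * B6.c1 d ρ α' * (1 - θ * B6.c1 d ρ α')⁻¹ * P a *
        Real.exp (-((1 - 3 * α') * ρ * g.dist a b))) := by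
  have h263 := B9Thm34Ext.h263_of_h261 g R H d ρ α' htri hρ hα' h261
  have htransfer : ∀ a b : g.Site, P a ≤ Λ * P b * Real.exp (α' * ρ * g.dist a b) :=
    transfer_of_scaleTransfer hsym hTρ
  have h342D : HasMajorantHom (g := toB6 g R H) blk blk (GU * Ds)
      (fun a b => B₀ * (fun _ : g.Site => (1 : ℝ)) a * P a * Real.exp (-(ρ * g.dist a b))) :=
    hasMajorantHom_mono (g := toB6 g R H) blk blk ((hasMajorantHom_iff (g := toB6 g R H) blk (GU * Ds) _).2 h342R)
      fun a b => by simp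
  have hGV' : HasMajorant (g := toB6 g R H) blk (GU * V)
      (fun a b => θ * (fun _ : g.Site => (1 : ℝ)) a * ((fun _ : g.Site => (1 : ℝ)) b)⁻¹ *
        Real.exp (-(ρ * g.dist a b))) :=
    hasMajorant_mono (g := toB6 g R H) blk hGV fun a b => by simp
  have key := B6RandomWalkHom.b9_rightEntry_outputWeight_365 (R := R) (H := H) blk blk d ρ α' θ B₀ Λ
    (fun _ => (1 : ℝ)) P hB₀ hΛ (fun _ => one_pos) hP hθ hα'ρ hα'ρ2 htri hrefl hsym hdnn h261 h263 hsmall htransfer h342D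
    hGV' h386L
  refine hasMajorant_mono (g := toB6 g R H) blk ((hasMajorantHom_iff (g := toB6 g R H) blk (GExt * Ds) _).1 key)
    fun a b => le_of_eq ?_
  simp

/-- **The right entry with Theorem 3.4's explicit threshold** («there exists a positive constant α₁ such that …», p. 400):
`θ = κ₀B₀α₁` (`κ₀B₀ = κ₃₈₅`), `α₁ ≦ (2κ₀B₀c₁(α′))⁻¹` ⟹ `θc₁(α′) ≦ ½` ⟹ `G(U′U)∇* ≺ 2B₀Λ²c₁(α′)·P(y)·e^{−(1−3α′)ρd}` —
the (3.42)₃ shape with constant `2B₀Λ²c₁(α′)`, as `B9Ineq385VG.gExt_entry1_explicit` did for entry 1.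
[cite: Balaban1985BackgroundPropagators, Thm 3.4 p.400 + (3.86) p.407 + (3.42)₃ p.397] -/
theorem gExt_rightEntry_explicit (blk : W → g.Site) (d : ℕ) (ρ α' κ₀ B₀ α₁ Λ : ℝ) (P : g.Site → ℝ)
    (hB₀ : 0 < B₀) (hκ₀ : 0 < κ₀) (hα₁ : 0 ≤ α₁) (hΛ : 0 ≤ Λ) (hP : ∀ y, 0 ≤ P y) (hρ : 0 ≤ ρ) (hα' : α' ≤ 1)
    (hα'ρ : 0 ≤ α' * ρ) (hα'ρ2 : 0 ≤ (1 - 2 * α') * ρ) (hc₁ : 0 < B6.c1 d ρ α')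
    (htri : Triangle254 (toB6 g R H)) (hrefl : ∀ y : g.Site, g.dist y y = 0)
    (hsym : ∀ y y' : g.Site, g.dist y y' = g.dist y' y) (hdnn : ∀ y y' : g.Site, 0 ≤ g.dist y y')
    (h261 : Ineq261 d (toB6 g R H) ρ α') (hTρ : ScaleTransfer g ρ α' Λ P)
    (ha₁ : α₁ ≤ (2 * κ₀ * B₀ * B6.c1 d ρ α')⁻¹)
    {GU GExt V Ds : Module.End ℝ (W → ℝ)}
    (h342R : HasMajorant (g := toB6 g R H) blk (GU * Ds) (fun a b => B₀ * P a * Real.exp (-(ρ * g.dist a b))))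
    (hGV : HasMajorant (g := toB6 g R H) blk (GU * V) (fun a b => κ₀ * B₀ * α₁ * Real.exp (-(ρ * g.dist a b))))
    (h386L : GExt = GU + GU * V * GExt) :
    HasMajorant (g := toB6 g R H) blk (GExt * Ds)
      (fun a b => 2 * B₀ * Λ ^ 2 * B6.c1 d ρ α' * P a * Real.exp (-((1 - 3 * α') * ρ * g.dist a b))) := by
  set θ : ℝ := κ₀ * B₀ * α₁ with hθdef
  set c : ℝ := B6.c1 d ρ α' with hcdef
  have hθ : 0 ≤ θ := by positivity
  have hprod : 0 < 2 * κ₀ * B₀ * c := by positivity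
  -- θc ≤ 1/2 from α₁ ≤ (2κ₀B₀c)⁻¹
  have hθc : θ * c ≤ 1 / 2 := by
    have h1 : α₁ * (2 * κ₀ * B₀ * c) ≤ 1 := by
      have := mul_le_mul_of_nonneg_right ha₁ hprod.le
      rwa [inv_mul_cancel₀ hprod.ne'] at this
    have : θ * c = α₁ * (2 * κ₀ * B₀ * c) / 2 := by rw [hθdef]; ring
    rw [this]
    linarith
  have hsmall : θ * c < 1 := by linarith
  have hinv : (1 - θ * c)⁻¹ ≤ 2 := by
    rw [inv_le_comm₀ (by linarith) (by norm_num : (0 : ℝ) < 2)]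
    linarith
  have h := gExt_rightEntry_of_386L (R := R) (H := H) blk d ρ α' θ B₀ Λ P hB₀.le hΛ hP hθ hρ hα' hα'ρ hα'ρ2 htri hrefl
    hsym hdnn h261 hsmall hTρ h342R hGV h386L
  refine hasMajorant_mono (g := toB6 g R H) blk h fun a b => ?_
  have hK : 0 ≤ B₀ * Λ ^ 2 * c * P a * Real.exp (-((1 - 3 * α') * ρ * g.dist a b)) :=
    mul_nonneg (mul_nonneg (mul_nonneg (mul_nonneg hB₀.le (sq_nonneg _)) hc₁.le) (hP a)) (Real.exp_nonneg _)
  calc B₀ * Λ ^ 2 * c * (1 - θ * c)⁻¹ * P a * Real.exp (-((1 - 3 * α') * ρ * g.dist a b))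
      = (1 - θ * c)⁻¹ * (B₀ * Λ ^ 2 * c * P a * Real.exp (-((1 - 3 * α') * ρ * g.dist a b))) := by ring
    _ ≤ 2 * (B₀ * Λ ^ 2 * c * P a * Real.exp (-((1 - 3 * α') * ρ * g.dist a b))) :=
        mul_le_mul_of_nonneg_right hinv hK
    _ = 2 * B₀ * Λ ^ 2 * c * P a * Real.exp (-((1 - 3 * α') * ρ * g.dist a b)) := by ring

end RightEntry

/-! ## §3  The left composite `G(U)V(A)` from the divergence-form reading of `V₃` -/

section LeftComposite

variable {g : B9.Geometry} [Fintype g.Site] {R : ℝ} {H : Prop} {W : Type}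

/-- **`G(U)V(A) ≺ κ₃₈₅·α₁·e^{−ρd}` — the mirror image of (3.85), from printed-TYPE inputs and the divergence-form reading.**
LETTERS: `V(A) = B9Eq386Neumann.vTotal V₃ P₁ P₂ = V₃ + P₁ + P₂` ((3.84)); `V₃ = ∇♯·B₃ + C₃` (`hV₃div`) — the first-order
local differential operator of (3.70)–(3.75) with its difference letter `∇♯` ON THE LEFT and coefficients of the (3.73)
sizes `B₃ ≺ c_Vα₁(Lʲη)⁻¹e^{−δd}`, `C₃ ≺ c_Vα₁(Lʲη)⁻²e^{−δd}` (READING, see the module docstring (ii)); `P₁ ≺ κ₁α₁(Lʲη)⁻²e^{−δd}`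
((3.77)); `P₂ ≺ κ₂α₁(Lʲη)⁻²e^{−δd}` ((3.83)); Theorem 3.3 for `G(U)`: (3.42)₁ `G ≺ B₀(Lʲη)²e^{−δd}` and (3.42)₃ for the letter
`∇♯`, `G∇♯ ≺ B₀Lʲη e^{−δd}` («we may always replace ∇_U by ∇*_U», p. 398); the scale transfers of `(Lʲη)⁻¹`, `(Lʲη)⁻²` at
exponent `α` with constant `Λ ≧ 0`, (2.61) at `β`, (2.54), `d ≧ 0`, `Lʲη > 0`.  CONCLUSION: for `ρ ≧ 0` with `ρ + (α+β)δ₀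
≦ δ`, `G(U)V(A) ≺ κ₃₈₅·α₁·e^{−ρd(y,y′)}`, `κ₃₈₅ = B₀Λc(2c_V + κ₁ + κ₂) = B9Ineq385VG.kappa385` — the four words `(G∇♯)B₃`,
`GC₃`, `GP₁`, `GP₂`, one composition each.
[cite: Balaban1985BackgroundPropagators, (3.84)–(3.86) p.407 + (3.70)–(3.73) pp.404–405 + (3.77) p.406 + (3.83) p.407 + Thm 3.3 p.399 + (3.42) p.397 + p.398 (remarks); Balaban1984PropagatorsII, Lemma 2.1 p.234 + (2.52)–(2.55) p.232] -/
theorem hasMajorant_GV_of_divForm (blk : W → g.Site) (d : ℕ) (δ₀ δ α β ρ Λ B₀ cV κ₁ κ₂ α₁ : ℝ)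
    (hB₀ : 0 ≤ B₀) (hcV : 0 ≤ cV) (hκ₁ : 0 ≤ κ₁) (hκ₂ : 0 ≤ κ₂) (hα₁ : 0 ≤ α₁) (hΛ : 0 ≤ Λ) (hρ : 0 ≤ ρ)
    (hα : 0 ≤ α) (hβ : 0 ≤ β) (hδ₀ : 0 ≤ δ₀) (hr : ρ + (α + β) * δ₀ ≤ δ)
    (hdnn : ∀ a b : g.Site, 0 ≤ g.dist a b) (htri : Triangle254 (toB6 g R H)) (hlen : ∀ y : g.Site, 0 < g.len y)
    (h261 : Ineq261 d (toB6 g R H) δ₀ β)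
    (hT1i : ScaleTransfer g δ₀ α Λ (fun a => (g.len a)⁻¹)) (hT2i : ScaleTransfer g δ₀ α Λ (fun a => (g.len a ^ 2)⁻¹))
    {G Dv V₃ B₃ C₃ P₁ P₂ : Module.End ℝ (W → ℝ)} (hV₃div : V₃ = Dv * B₃ + C₃)
    (hB₃ : HasMajorant (g := toB6 g R H) blk B₃ (fun a b => cV * α₁ * (g.len a)⁻¹ * Real.exp (-(δ * g.dist a b))))
    (hC₃ : HasMajorant (g := toB6 g R H) blk C₃
      (fun a b => cV * α₁ * (g.len a ^ 2)⁻¹ * Real.exp (-(δ * g.dist a b))))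
    (hP₁ : HasMajorant (g := toB6 g R H) blk P₁ (fun a b => κ₁ * α₁ * (g.len a ^ 2)⁻¹ * Real.exp (-(δ * g.dist a b))))
    (hP₂ : HasMajorant (g := toB6 g R H) blk P₂ (fun a b => κ₂ * α₁ * (g.len a ^ 2)⁻¹ * Real.exp (-(δ * g.dist a b))))
    (hG : HasMajorant (g := toB6 g R H) blk G (fun a b => B₀ * g.len a ^ 2 * Real.exp (-(δ * g.dist a b))))
    (hGDv : HasMajorant (g := toB6 g R H) blk (G * Dv) (fun a b => B₀ * g.len a * Real.exp (-(δ * g.dist a b)))) :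
    HasMajorant (g := toB6 g R H) blk (G * vTotal V₃ P₁ P₂)
      (fun a b => kappa385 B₀ cV κ₁ κ₂ Λ (B6.c1 d δ₀ β) * α₁ * Real.exp (-(ρ * g.dist a b))) := by
  have hw1 : ∀ a : g.Site, 0 ≤ g.len a := fun a => (hlen a).le
  have hw2 : ∀ a : g.Site, 0 ≤ g.len a ^ 2 := fun a => sq_nonneg _
  have hw1i : ∀ a : g.Site, 0 ≤ (g.len a)⁻¹ := fun a => inv_nonneg.mpr (hlen a).le
  have hw2i : ∀ a : g.Site, 0 ≤ (g.len a ^ 2)⁻¹ := fun a => inv_nonneg.mpr (sq_nonneg _)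
  have hcVα : 0 ≤ cV * α₁ := mul_nonneg hcV hα₁
  have hκ₁α : 0 ≤ κ₁ * α₁ := mul_nonneg hκ₁ hα₁
  have hκ₂α : 0 ≤ κ₂ * α₁ := mul_nonneg hκ₂ hα₁
  have hρδ : ρ ≤ δ := by
    have : 0 ≤ (α + β) * δ₀ := by positivity
    linarith
  -- rate-weakened right letters
  have hB₃ρ := hasMajorant_rate_mono (R := R) (H := H) blk (cV * α₁) (fun a => (g.len a)⁻¹) hcVα hw1i hρδ hdnn hB₃
  have hC₃ρ := hasMajorant_rate_mono (R := R) (H := H) blk (cV * α₁) (fun a => (g.len a ^ 2)⁻¹) hcVα hw2i hρδ hdnn hC₃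
  have hP₁ρ := hasMajorant_rate_mono (R := R) (H := H) blk (κ₁ * α₁) (fun a => (g.len a ^ 2)⁻¹) hκ₁α hw2i hρδ hdnn hP₁
  have hP₂ρ := hasMajorant_rate_mono (R := R) (H := H) blk (κ₂ * α₁) (fun a => (g.len a ^ 2)⁻¹) hκ₂α hw2i hρδ hdnn hP₂
  -- the four words
  have w1 := hasMajorant_comp_decay (R := R) (H := H) blk d δ₀ α β ρ δ Λ B₀ (cV * α₁) (fun a => g.len a)
    (fun a => (g.len a)⁻¹) hw1 hw1i hΛ hB₀ hcVα hρ hr hdnn htri hT1i h261 hGDv hB₃ρ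
  have w2 := hasMajorant_comp_decay (R := R) (H := H) blk d δ₀ α β ρ δ Λ B₀ (cV * α₁) (fun a => g.len a ^ 2)
    (fun a => (g.len a ^ 2)⁻¹) hw2 hw2i hΛ hB₀ hcVα hρ hr hdnn htri hT2i h261 hG hC₃ρ
  have w3 := hasMajorant_comp_decay (R := R) (H := H) blk d δ₀ α β ρ δ Λ B₀ (κ₁ * α₁) (fun a => g.len a ^ 2)
    (fun a => (g.len a ^ 2)⁻¹) hw2 hw2i hΛ hB₀ hκ₁α hρ hr hdnn htri hT2i h261 hG hP₁ρ
  have w4 := hasMajorant_comp_decay (R := R) (H := H) blk d δ₀ α β ρ δ Λ B₀ (κ₂ * α₁) (fun a => g.len a ^ 2)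
    (fun a => (g.len a ^ 2)⁻¹) hw2 hw2i hΛ hB₀ hκ₂α hρ hr hdnn htri hT2i h261 hG hP₂ρ
  have hsum := hasMajorant_add (g := toB6 g R H) blk
    (hasMajorant_add (g := toB6 g R H) blk (hasMajorant_add (g := toB6 g R H) blk w1 w2) w3) w4
  have e : G * vTotal V₃ P₁ P₂ = G * Dv * B₃ + G * C₃ + G * P₁ + G * P₂ := by
    rw [vTotal, hV₃div]
    noncomm_ring
  rw [e]
  refine hasMajorant_mono (g := toB6 g R H) blk hsum fun a b => le_of_eq ?_
  have ha : g.len a ≠ 0 := (hlen a).ne'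
  simp only [kappa385]
  field_simp
  ring

end LeftComposite

/-! ## §4  Entry 3 for `G(U′U)` from the §3 letters; Theorem 3.4's `G`-part, entries 1 and 3 for the same `G(U′U)` -/

section Assembly

variable {g : B9.Geometry} [Fintype g.Site] {R : ℝ} {H : Prop} {W : Type} [Fintype W] [DecidableEq W]

/-- **(3.42)₃ for `G(U′U)` from the divergence-form letters and the left resolvent identity of (3.86)**: with `G(U)V(A) ≺
κ₃₈₅α₁e^{−ρd}` (§3), (3.42)₃ `G(U)∇* ≺ B₀Lʲη e^{−δd}` for `G(U)`, `G(U′U) = G(U) + G(U)V(A)G(U′U)`, Lemma 2.1 of [4] at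
`(ρ, α′)`, the convention at `(ρ, α′)` (constant `Λ_ρ`) and the located smallness `κ₃₈₅α₁c₁(α′) < 1`: `G(U′U)∇* ≺
B₀Λ_ρ²c₁(α′)(1 − κ₃₈₅α₁c₁(α′))⁻¹Lʲη e^{−(1−3α′)ρd}`.
[cite: Balaban1985BackgroundPropagators, (3.84)–(3.86) p.407 + Thm 3.3 p.399 + (3.42) p.397 + p.398 (remarks); Balaban1984PropagatorsII, (2.66) p.234 + Lemma 2.1 p.234] -/
theorem gExt_entry3_of_385div_386L (blk : W → g.Site) (d : ℕ) (δ₀ δ α β ρ α' Λ Λρ B₀ cV κ₁ κ₂ α₁ : ℝ)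
    (hB₀ : 0 ≤ B₀) (hcV : 0 ≤ cV) (hκ₁ : 0 ≤ κ₁) (hκ₂ : 0 ≤ κ₂) (hα₁ : 0 ≤ α₁) (hΛ : 0 ≤ Λ) (hΛρ : 0 ≤ Λρ)
    (hρ : 0 ≤ ρ) (hα : 0 ≤ α) (hβ : 0 ≤ β) (hδ₀ : 0 ≤ δ₀) (hr : ρ + (α + β) * δ₀ ≤ δ) (hα' : α' ≤ 1)
    (hα'ρ : 0 ≤ α' * ρ) (hα'ρ2 : 0 ≤ (1 - 2 * α') * ρ)
    (hdnn : ∀ a b : g.Site, 0 ≤ g.dist a b) (htri : Triangle254 (toB6 g R H)) (hrefl : ∀ y : g.Site, g.dist y y = 0)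
    (hsym : ∀ y y' : g.Site, g.dist y y' = g.dist y' y) (hlen : ∀ y : g.Site, 0 < g.len y)
    (h261 : Ineq261 d (toB6 g R H) δ₀ β) (h261' : Ineq261 d (toB6 g R H) ρ α')
    (hT1i : ScaleTransfer g δ₀ α Λ (fun a => (g.len a)⁻¹)) (hT2i : ScaleTransfer g δ₀ α Λ (fun a => (g.len a ^ 2)⁻¹))
    (hTρ : ScaleTransfer g ρ α' Λρ (fun a => g.len a))
    (hsmall : kappa385 B₀ cV κ₁ κ₂ Λ (B6.c1 d δ₀ β) * α₁ * B6.c1 d ρ α' < 1)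
    {G GExt Dv Ds V₃ B₃ C₃ P₁ P₂ : Module.End ℝ (W → ℝ)} (hV₃div : V₃ = Dv * B₃ + C₃)
    (hB₃ : HasMajorant (g := toB6 g R H) blk B₃ (fun a b => cV * α₁ * (g.len a)⁻¹ * Real.exp (-(δ * g.dist a b))))
    (hC₃ : HasMajorant (g := toB6 g R H) blk C₃
      (fun a b => cV * α₁ * (g.len a ^ 2)⁻¹ * Real.exp (-(δ * g.dist a b))))
    (hP₁ : HasMajorant (g := toB6 g R H) blk P₁ (fun a b => κ₁ * α₁ * (g.len a ^ 2)⁻¹ * Real.exp (-(δ * g.dist a b))))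
    (hP₂ : HasMajorant (g := toB6 g R H) blk P₂ (fun a b => κ₂ * α₁ * (g.len a ^ 2)⁻¹ * Real.exp (-(δ * g.dist a b))))
    (hG : HasMajorant (g := toB6 g R H) blk G (fun a b => B₀ * g.len a ^ 2 * Real.exp (-(δ * g.dist a b))))
    (hGDv : HasMajorant (g := toB6 g R H) blk (G * Dv) (fun a b => B₀ * g.len a * Real.exp (-(δ * g.dist a b))))
    (hGDs : HasMajorant (g := toB6 g R H) blk (G * Ds) (fun a b => B₀ * g.len a * Real.exp (-(δ * g.dist a b))))
    (h386L : GExt = G + G * vTotal V₃ P₁ P₂ * GExt) :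
    HasMajorant (g := toB6 g R H) blk (GExt * Ds)
      (fun a b => B₀ * Λρ ^ 2 * B6.c1 d ρ α' * (1 - kappa385 B₀ cV κ₁ κ₂ Λ (B6.c1 d δ₀ β) * α₁ * B6.c1 d ρ α')⁻¹ *
        g.len a * Real.exp (-((1 - 3 * α') * ρ * g.dist a b))) := by
  have hGV := hasMajorant_GV_of_divForm (R := R) (H := H) blk d δ₀ δ α β ρ Λ B₀ cV κ₁ κ₂ α₁ hB₀ hcV hκ₁ hκ₂ hα₁ hΛ hρ
    hα hβ hδ₀ hr hdnn htri hlen h261 hT1i hT2i hV₃div hB₃ hC₃ hP₁ hP₂ hG hGDv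
  have hρδ : ρ ≤ δ := by
    have : 0 ≤ (α + β) * δ₀ := by positivity
    linarith
  have hGDsρ := hasMajorant_rate_mono (R := R) (H := H) blk B₀ (fun a => g.len a) hB₀ (fun a => (hlen a).le) hρδ hdnn
    hGDs
  have hθ : 0 ≤ kappa385 B₀ cV κ₁ κ₂ Λ (B6.c1 d δ₀ β) * α₁ :=
    mul_nonneg (kappa385_nonneg hB₀ hcV hκ₁ hκ₂ hΛ (B6RandomWalk.c1_nonneg d δ₀ β)) hα₁
  exact gExt_rightEntry_of_386L (R := R) (H := H) blk d ρ α' _ B₀ Λρ (fun a => g.len a) hB₀ hΛρ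
    (fun a => (hlen a).le) hθ hρ hα' hα'ρ hα'ρ2 htri hrefl hsym hdnn h261' hsmall hTρ hGDsρ hGV h386L

/-- **Theorem 3.4, `G`-part, entries (3.42)₁ and (3.42)₃ for ONE AND THE SAME `G(U′U)`, operator form, no hypothesis on
`G(U′U)`** («Thus Theorem 3.4 is proved, assuming that Theorems 3.1–3.3 hold» — the sup-entries `G(U′U)λ` and `G(U′U)∇*_Uλ`).
The hypotheses of `B9Ineq385VG.thm34_G_entry1_opForm` (the (3.73)/(3.77)/(3.83)-letters with `V₃ = V⁰ + V¹·∇` in gradient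
form for (3.85), Theorem 3.3's (3.42)₁,₂ for `G(U)`, `Δ_a(U)G(U) = G(U)Δ_a(U) = I` ((3.27)), the expansions (3.71)/(3.76)/(3.80))
PLUS the divergence-form reading of the same `V₃` (`hV₃div`, `hB₃`, `hC₃`, see (ii) of the module docstring), (3.42)₃ for
`G(U)` and for the letter `∇♯` (`hGDs`, `hGDv`), the symmetry of `d` and the convention at `(ρ, α′)`: THERE IS an operator
`G(U′U)`, the two-sided inverse of `Δ_a(U′U) = B9Eq386Neumann.deltaA DsD′ Δp′ DRDs′ Qs′ a Q′`, with
`G(U′U) ≺ B₀c₁(α′)(1 − κ₃₈₅α₁c₁(α′))⁻¹(Lʲη)²e^{−(1−α′)ρd}` AND `G(U′U)∇* ≺ B₀Λ_ρ²c₁(α′)(1 − κ₃₈₅α₁c₁(α′))⁻¹Lʲη e^{−(1−3α′)ρd}`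
— one smallness condition `κ₃₈₅α₁c₁(α′) < 1` for both, since the left composite `G(U)V(A)` and the right composite
`V(A)G(U)` carry the same constant `κ₃₈₅`.
[cite: Balaban1985BackgroundPropagators, Thm 3.4 p.400 + (3.82)–(3.86) p.407 + (3.27) p.395 + (3.42) p.397 + p.398 (remarks); Balaban1984PropagatorsII, (2.66) p.234 + Lemma 2.1 p.234] -/
theorem thm34_G_entries13_opForm (blk : W → g.Site) (d : ℕ) (δ₀ δ α β ρ α' Λ Λρ B₀ cV κ₁ κ₂ α₁ : ℝ)
    (hB₀ : 0 ≤ B₀) (hcV : 0 ≤ cV) (hκ₁ : 0 ≤ κ₁) (hκ₂ : 0 ≤ κ₂) (hα₁ : 0 ≤ α₁) (hΛ : 0 ≤ Λ) (hΛρ : 0 ≤ Λρ)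
    (hρ : 0 ≤ ρ) (hα : 0 ≤ α) (hβ : 0 ≤ β) (hδ₀ : 0 ≤ δ₀) (hr : ρ + (α + β) * δ₀ ≤ δ) (hα' : α' ≤ 1)
    (hα'ρ0 : 0 ≤ α' * ρ) (hα'ρ2 : 0 ≤ (1 - 2 * α') * ρ)
    (hdnn : ∀ a b : g.Site, 0 ≤ g.dist a b) (htri : Triangle254 (toB6 g R H)) (hrefl : ∀ y : g.Site, g.dist y y = 0)
    (hsym : ∀ y y' : g.Site, g.dist y y' = g.dist y' y) (hlen : ∀ y : g.Site, 0 < g.len y)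
    (h261 : Ineq261 d (toB6 g R H) δ₀ β) (h261' : Ineq261 d (toB6 g R H) ρ α')
    (hT1 : ScaleTransfer g δ₀ α Λ (fun a => g.len a)) (hT2 : ScaleTransfer g δ₀ α Λ (fun a => g.len a ^ 2))
    (hT1i : ScaleTransfer g δ₀ α Λ (fun a => (g.len a)⁻¹)) (hT2i : ScaleTransfer g δ₀ α Λ (fun a => (g.len a ^ 2)⁻¹))
    (hTρ : ScaleTransfer g ρ α' Λρ (fun a => g.len a))
    (hsmall : kappa385 B₀ cV κ₁ κ₂ Λ (B6.c1 d δ₀ β) * α₁ * B6.c1 d ρ α' < 1)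
    {G D Dv Ds V₃ V0 V1 B₃ C₃ P₁ P₂ DsD DsD' Δp Δp' DRDs DRDs' Qs Qs' Q Q' a V₁ V₂ F₂ F₂s : Module.End ℝ (W → ℝ)}
    (hV₃ : V₃ = V0 + V1 * D) (hV₃div : V₃ = Dv * B₃ + C₃) (hV₃' : V₃ = B9Eq386Neumann.vThree V₁ V₂ Δp Δp')
    (h371 : DsD' = DsD - V₁) (h376 : DRDs' = DRDs - V₂ - P₁) (h380 : Q' = Q + F₂) (h380s : Qs' = Qs + F₂s)
    (hP₂def : P₂ = pTwo Qs Q F₂ F₂s a)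
    (hΔG : B9Eq386Neumann.deltaA DsD Δp DRDs Qs a Q * G = 1) (hGΔ : G * B9Eq386Neumann.deltaA DsD Δp DRDs Qs a Q = 1)
    (hV0 : HasMajorant (g := toB6 g R H) blk V0
      (fun a b => cV * α₁ * (g.len a ^ 2)⁻¹ * Real.exp (-(δ * g.dist a b))))
    (hV1 : HasMajorant (g := toB6 g R H) blk V1 (fun a b => cV * α₁ * (g.len a)⁻¹ * Real.exp (-(δ * g.dist a b))))
    (hB₃ : HasMajorant (g := toB6 g R H) blk B₃ (fun a b => cV * α₁ * (g.len a)⁻¹ * Real.exp (-(δ * g.dist a b))))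
    (hC₃ : HasMajorant (g := toB6 g R H) blk C₃
      (fun a b => cV * α₁ * (g.len a ^ 2)⁻¹ * Real.exp (-(δ * g.dist a b))))
    (hP₁ : HasMajorant (g := toB6 g R H) blk P₁ (fun a b => κ₁ * α₁ * (g.len a ^ 2)⁻¹ * Real.exp (-(δ * g.dist a b))))
    (hP₂ : HasMajorant (g := toB6 g R H) blk P₂ (fun a b => κ₂ * α₁ * (g.len a ^ 2)⁻¹ * Real.exp (-(δ * g.dist a b))))
    (hG : HasMajorant (g := toB6 g R H) blk G (fun a b => B₀ * g.len a ^ 2 * Real.exp (-(δ * g.dist a b))))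
    (hDG : HasMajorant (g := toB6 g R H) blk (D * G) (fun a b => B₀ * g.len a * Real.exp (-(δ * g.dist a b))))
    (hGDv : HasMajorant (g := toB6 g R H) blk (G * Dv) (fun a b => B₀ * g.len a * Real.exp (-(δ * g.dist a b))))
    (hGDs : HasMajorant (g := toB6 g R H) blk (G * Ds) (fun a b => B₀ * g.len a * Real.exp (-(δ * g.dist a b)))) :
    ∃ GExt : Module.End ℝ (W → ℝ),
      B9Eq386Neumann.deltaA DsD' Δp' DRDs' Qs' a Q' * GExt = 1 ∧ GExt * B9Eq386Neumann.deltaA DsD' Δp' DRDs' Qs' a Q' = 1 ∧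
      HasMajorant (g := toB6 g R H) blk GExt
        (fun a b => B₀ * B6.c1 d ρ α' * (1 - kappa385 B₀ cV κ₁ κ₂ Λ (B6.c1 d δ₀ β) * α₁ * B6.c1 d ρ α')⁻¹ *
          g.len a ^ 2 * Real.exp (-((1 - α') * ρ * g.dist a b))) ∧
      HasMajorant (g := toB6 g R H) blk (GExt * Ds)
        (fun a b => B₀ * Λρ ^ 2 * B6.c1 d ρ α' * (1 - kappa385 B₀ cV κ₁ κ₂ Λ (B6.c1 d δ₀ β) * α₁ * B6.c1 d ρ α')⁻¹ *
          g.len a * Real.exp (-((1 - 3 * α') * ρ * g.dist a b))) := by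
  -- (3.85)
  have h385 := ineq385_op (R := R) (H := H) blk d δ₀ δ α β ρ Λ B₀ cV κ₁ κ₂ α₁ hB₀ hcV hκ₁ hκ₂ hα₁ hΛ hρ hα hβ hδ₀ hr
    hdnn htri hlen h261 hT1 hT2 hV₃ hV0 hV1 hP₁ hP₂ hG hDG
  have hθ : 0 ≤ kappa385 B₀ cV κ₁ κ₂ Λ (B6.c1 d δ₀ β) * α₁ :=
    mul_nonneg (kappa385_nonneg hB₀ hcV hκ₁ hκ₂ hΛ (B6RandomWalk.c1_nonneg d δ₀ β)) hα₁
  have hα'ρ : 0 ≤ (1 - α') * ρ := by nlinarith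
  -- (3.84): Δ_a(U′U) = Δ_a(U) − V(A)
  have h384 : B9Eq386Neumann.deltaA DsD' Δp' DRDs' Qs' a Q' =
      B9Eq386Neumann.deltaA DsD Δp DRDs Qs a Q - vTotal V₃ P₁ P₂ := by
    rw [B9Eq386Neumann.eq384_sub DsD DsD' Δp Δp' DRDs DRDs' Qs Qs' Q Q' a V₁ V₂ P₁ F₂ F₂s h371 h376 h380 h380s,
      hV₃', hP₂def]
  -- (3.86): existence with both resolvent identities and the inverse property (`B9Ineq385VG.exists_gExt_of_385` =
  -- gen 2's `B9Eq360Vprime.exists_gPrimeExt_of_363` read through `toB6`)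
  obtain ⟨GExt, h386L, h386, hL, hR⟩ := B9Eq360Vprime.exists_gPrimeExt_of_363 (g := toB6 g R H) blk d ρ α' _ hθ hα'ρ
    hdnn h261' hsmall (B9Eq386Neumann.deltaA DsD Δp DRDs Qs a Q) G (vTotal V₃ P₁ P₂) hΔG hGΔ h385
  refine ⟨GExt, ?_, ?_, ?_, ?_⟩
  · rw [h384]; exact hL
  · rw [h384]; exact hR
  · have hρδ : ρ ≤ δ := by
      have : 0 ≤ (α + β) * δ₀ := by positivity
      linarith
    have hGρ := hasMajorant_rate_mono (R := R) (H := H) blk B₀ (fun a => g.len a ^ 2) hB₀ (fun a => sq_nonneg _) hρδ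
      hdnn hG
    exact gExt_entry1_of_386 (R := R) (H := H) blk d ρ α' _ B₀ (fun a => g.len a ^ 2) hB₀ (fun a => sq_nonneg _) hθ hρ
      hα' hα'ρ htri hrefl hdnn h261' hsmall hGρ h385 h386
  · exact gExt_entry3_of_385div_386L (R := R) (H := H) blk d δ₀ δ α β ρ α' Λ Λρ B₀ cV κ₁ κ₂ α₁ hB₀ hcV hκ₁ hκ₂ hα₁ hΛ
      hΛρ hρ hα hβ hδ₀ hr hα' hα'ρ0 hα'ρ2 hdnn htri hrefl hsym hlen h261 h261' hT1i hT2i hTρ hsmall hV₃div hB₃ hC₃ hP₁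
      hP₂ hG hGDv hGDs h386L

end Assembly

/-! ## §5  (v1.1) The divergence-form letters from the gradient form (3.73) and ONE commutator letter

(3.70)–(3.71) and (3.74)–(3.75) (pp. 404–405) display `V₁(A)`, `V₂(A)` as sums of terms «[−iadA_ν(x), R(U(x, x+ηe_μ))
(D*A′_ν)(x+ηe_μ)]» (a coefficient of size `|A|` composed with a transported covariant difference of the ARGUMENT — the
gradient form `V¹∇`) and «iad(D_μA_ν)(x)R(U(x, x+ηe_μ))A′_λ(x+ηe_μ)» (a coefficient of size `|∇A|` on the argument), minus the
local bounded remainders `F_{1,k}(A)`, `F_{2,k}(A)` of (3.72) (size `O(1)|A|²`) — together the zeroth-order part `V⁰`; (3.73)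
bounds them in this gradient form.  Moving the difference to the LEFT of the coefficient is the lattice Leibniz rule
`V¹∇ = ∇V¹ + [V¹, ∇]`, the commutator being the (transported) covariant difference of the coefficient, of size
`|∇^η_UA| < α₁(Lʲη)⁻²` on the domain (3.37) p. 396 («|A′| < α₁(Lʲη)⁻¹, |∇^η_UA′| < α₁(Lʲη)⁻² on Ω_j»).  This section keeps
that commutator as ONE letter with a located majorant (`hComm`) and derives from it the four divergence-form hypotheses of
§3–§4; nothing about the concrete `V₃` is asserted (the identification of `[V¹, ∇]` on a concrete carrier stays with the
reader, GAPS G-pv21g2-2). -/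

section Commutator

variable {g : B9.Geometry} [Fintype g.Site] {R : ℝ} {H : Prop} {W : Type}

/-- **Lattice Leibniz rule, letter form**: the gradient form `V₃ = V⁰ + V¹∇` IS a divergence form `V₃ = ∇V¹ + C₃` with
`C₃ = V⁰ + (V¹∇ − ∇V¹)` (ring identity; the content is in the size of the commutator, `hasMajorant_C₃_of_comm`).
[cite: Balaban1985BackgroundPropagators, (3.70)–(3.71) pp.404–405 + (3.74)–(3.75) p.405] -/
theorem divForm_of_gradForm {V₃ V0 V1 D : Module.End ℝ (W → ℝ)} (hV₃ : V₃ = V0 + V1 * D) :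
    V₃ = D * V1 + (V0 + (V1 * D - D * V1)) := by
  rw [hV₃]
  abel

/-- **The zeroth-order letter of the divergence form**: from the (3.73) size of `V⁰` (`≺ c_Vα₁(Lʲη)⁻²e^{−δd}`) and the located
commutator letter `V¹∇ − ∇V¹ ≺ c_Kα₁(Lʲη)⁻²e^{−δd}` (the (3.37) size of the coefficient differences), `C₃ = V⁰ + (V¹∇ − ∇V¹)
≺ (c_V + c_K)α₁(Lʲη)⁻²e^{−δd}` ([4] (2.52): a sum preserves majorants).
[cite: Balaban1985BackgroundPropagators, (3.73) p.405 + (3.37) p.396; Balaban1984PropagatorsII, (2.51)–(2.52) p.232] -/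
theorem hasMajorant_C₃_of_comm (blk : W → g.Site) (δ cV cK α₁ : ℝ) {V0 V1 D : Module.End ℝ (W → ℝ)}
    (hV0 : HasMajorant (g := toB6 g R H) blk V0
      (fun a b => cV * α₁ * (g.len a ^ 2)⁻¹ * Real.exp (-(δ * g.dist a b))))
    (hComm : HasMajorant (g := toB6 g R H) blk (V1 * D - D * V1)
      (fun a b => cK * α₁ * (g.len a ^ 2)⁻¹ * Real.exp (-(δ * g.dist a b)))) :
    HasMajorant (g := toB6 g R H) blk (V0 + (V1 * D - D * V1))
      (fun a b => (cV + cK) * α₁ * (g.len a ^ 2)⁻¹ * Real.exp (-(δ * g.dist a b))) := by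
  refine hasMajorant_mono (g := toB6 g R H) blk (hasMajorant_add (g := toB6 g R H) blk hV0 hComm) fun a b => le_of_eq ?_
  ring

/-- **`G(U)V(A) ≺ κ₃₈₅(c_V + c_K)·α₁·e^{−ρd}` from the GRADIENT form and the commutator letter.**  The hypotheses of §3's
`hasMajorant_GV_of_divForm` with its four divergence-form letters replaced by: `V₃ = V⁰ + V¹∇` (`hV₃`, as in
`B9Ineq385VG.ineq385_op`), the (3.73) sizes of `V⁰`, `V¹` (`hV0`, `hV1`), the commutator letter (`hComm`) and Theorem 3.3's
entry for the product `G(U)∇` (`hGD : G∇ ≺ B₀Lʲη e^{−δd}`; «we may always replace ∇_U by ∇*_U», p. 398).  Proof: §3 at the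
letters `∇♯ := ∇`, `B₃ := V¹`, `C₃ := V⁰ + [V¹, ∇]` with `c_V + c_K` for `c_V`.
[cite: Balaban1985BackgroundPropagators, (3.84)–(3.86) p.407 + (3.70)–(3.73) pp.404–405 + (3.37) p.396 + (3.77) p.406 + (3.83) p.407 + Thm 3.3 p.399 + (3.42) p.397 + p.398 (remarks); Balaban1984PropagatorsII, Lemma 2.1 p.234 + (2.52)–(2.55) p.232] -/
theorem hasMajorant_GV_of_gradForm_comm (blk : W → g.Site) (d : ℕ) (δ₀ δ α β ρ Λ B₀ cV cK κ₁ κ₂ α₁ : ℝ)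
    (hB₀ : 0 ≤ B₀) (hcV : 0 ≤ cV) (hcK : 0 ≤ cK) (hκ₁ : 0 ≤ κ₁) (hκ₂ : 0 ≤ κ₂) (hα₁ : 0 ≤ α₁) (hΛ : 0 ≤ Λ)
    (hρ : 0 ≤ ρ) (hα : 0 ≤ α) (hβ : 0 ≤ β) (hδ₀ : 0 ≤ δ₀) (hr : ρ + (α + β) * δ₀ ≤ δ)
    (hdnn : ∀ a b : g.Site, 0 ≤ g.dist a b) (htri : Triangle254 (toB6 g R H)) (hlen : ∀ y : g.Site, 0 < g.len y)
    (h261 : Ineq261 d (toB6 g R H) δ₀ β)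
    (hT1i : ScaleTransfer g δ₀ α Λ (fun a => (g.len a)⁻¹)) (hT2i : ScaleTransfer g δ₀ α Λ (fun a => (g.len a ^ 2)⁻¹))
    {G D V₃ V0 V1 P₁ P₂ : Module.End ℝ (W → ℝ)} (hV₃ : V₃ = V0 + V1 * D)
    (hV0 : HasMajorant (g := toB6 g R H) blk V0
      (fun a b => cV * α₁ * (g.len a ^ 2)⁻¹ * Real.exp (-(δ * g.dist a b))))
    (hV1 : HasMajorant (g := toB6 g R H) blk V1 (fun a b => cV * α₁ * (g.len a)⁻¹ * Real.exp (-(δ * g.dist a b))))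
    (hComm : HasMajorant (g := toB6 g R H) blk (V1 * D - D * V1)
      (fun a b => cK * α₁ * (g.len a ^ 2)⁻¹ * Real.exp (-(δ * g.dist a b))))
    (hP₁ : HasMajorant (g := toB6 g R H) blk P₁ (fun a b => κ₁ * α₁ * (g.len a ^ 2)⁻¹ * Real.exp (-(δ * g.dist a b))))
    (hP₂ : HasMajorant (g := toB6 g R H) blk P₂ (fun a b => κ₂ * α₁ * (g.len a ^ 2)⁻¹ * Real.exp (-(δ * g.dist a b))))
    (hG : HasMajorant (g := toB6 g R H) blk G (fun a b => B₀ * g.len a ^ 2 * Real.exp (-(δ * g.dist a b))))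
    (hGD : HasMajorant (g := toB6 g R H) blk (G * D) (fun a b => B₀ * g.len a * Real.exp (-(δ * g.dist a b)))) :
    HasMajorant (g := toB6 g R H) blk (G * vTotal V₃ P₁ P₂)
      (fun a b => kappa385 B₀ (cV + cK) κ₁ κ₂ Λ (B6.c1 d δ₀ β) * α₁ * Real.exp (-(ρ * g.dist a b))) := by
  have hcVK : 0 ≤ cV + cK := add_nonneg hcV hcK
  -- B₃ := V¹ at the weakened constant c_V + c_K
  have hB₃ : HasMajorant (g := toB6 g R H) blk V1
      (fun a b => (cV + cK) * α₁ * (g.len a)⁻¹ * Real.exp (-(δ * g.dist a b))) := by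
    refine hasMajorant_mono (g := toB6 g R H) blk hV1 fun a b => ?_
    have hw : 0 ≤ α₁ * (g.len a)⁻¹ * Real.exp (-(δ * g.dist a b)) :=
      mul_nonneg (mul_nonneg hα₁ (inv_nonneg.mpr (hlen a).le)) (Real.exp_nonneg _)
    nlinarith
  -- C₃ := V⁰ + [V¹, ∇]
  have hC₃ := hasMajorant_C₃_of_comm (R := R) (H := H) blk δ cV cK α₁ hV0 hComm
  exact hasMajorant_GV_of_divForm (R := R) (H := H) blk d δ₀ δ α β ρ Λ B₀ (cV + cK) κ₁ κ₂ α₁ hB₀ hcVK hκ₁ hκ₂ hα₁ hΛ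
    hρ hα hβ hδ₀ hr hdnn htri hlen h261 hT1i hT2i (divForm_of_gradForm hV₃) hB₃ hC₃ hP₁ hP₂ hG hGD

end Commutator

section AssemblyComm

variable {g : B9.Geometry} [Fintype g.Site] {R : ℝ} {H : Prop} {W : Type} [Fintype W] [DecidableEq W]

/-- **Theorem 3.4, `G`-part, entries (3.42)₁ and (3.42)₃ for one and the same `G(U′U)` — from the GRADIENT-form reading of
`V₃` alone plus the commutator letter.**  Exactly the hypotheses of §4's `thm34_G_entries13_opForm` with the divergence-form
letters `hV₃div`/`hB₃`/`hC₃`/`hGDv` replaced by `hComm : V¹∇ − ∇V¹ ≺ c_Kα₁(Lʲη)⁻²e^{−δd}` (the (3.37) size of the coefficient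
differences of (3.70)/(3.74)) and `hGD : G(U)∇ ≺ B₀Lʲη e^{−δd}` (Theorem 3.3, p. 398 remark); constants with `c_V + c_K` for
`c_V`: ∃ `G(U′U)`, the two-sided inverse of `Δ_a(U′U)`, with `G(U′U) ≺ B₀c₁(1 − κ₃₈₅′α₁c₁)⁻¹(Lʲη)²e^{−(1−α′)ρd}` and
`G(U′U)∇* ≺ B₀Λ_ρ²c₁(1 − κ₃₈₅′α₁c₁)⁻¹Lʲη e^{−(1−3α′)ρd}`, `κ₃₈₅′ = kappa385 B₀ (c_V + c_K) κ₁ κ₂ Λ c`, one smallness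
condition `κ₃₈₅′α₁c₁ < 1`.
[cite: Balaban1985BackgroundPropagators, Thm 3.4 p.400 + (3.82)–(3.86) p.407 + (3.70)–(3.73) pp.404–405 + (3.37) p.396 + (3.27) p.395 + (3.42) p.397 + p.398 (remarks); Balaban1984PropagatorsII, (2.66) p.234 + Lemma 2.1 p.234] -/
theorem thm34_G_entries13_opForm_of_comm (blk : W → g.Site) (d : ℕ) (δ₀ δ α β ρ α' Λ Λρ B₀ cV cK κ₁ κ₂ α₁ : ℝ)
    (hB₀ : 0 ≤ B₀) (hcV : 0 ≤ cV) (hcK : 0 ≤ cK) (hκ₁ : 0 ≤ κ₁) (hκ₂ : 0 ≤ κ₂) (hα₁ : 0 ≤ α₁) (hΛ : 0 ≤ Λ)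
    (hΛρ : 0 ≤ Λρ) (hρ : 0 ≤ ρ) (hα : 0 ≤ α) (hβ : 0 ≤ β) (hδ₀ : 0 ≤ δ₀) (hr : ρ + (α + β) * δ₀ ≤ δ) (hα' : α' ≤ 1)
    (hα'ρ0 : 0 ≤ α' * ρ) (hα'ρ2 : 0 ≤ (1 - 2 * α') * ρ)
    (hdnn : ∀ a b : g.Site, 0 ≤ g.dist a b) (htri : Triangle254 (toB6 g R H)) (hrefl : ∀ y : g.Site, g.dist y y = 0)
    (hsym : ∀ y y' : g.Site, g.dist y y' = g.dist y' y) (hlen : ∀ y : g.Site, 0 < g.len y)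
    (h261 : Ineq261 d (toB6 g R H) δ₀ β) (h261' : Ineq261 d (toB6 g R H) ρ α')
    (hT1 : ScaleTransfer g δ₀ α Λ (fun a => g.len a)) (hT2 : ScaleTransfer g δ₀ α Λ (fun a => g.len a ^ 2))
    (hT1i : ScaleTransfer g δ₀ α Λ (fun a => (g.len a)⁻¹)) (hT2i : ScaleTransfer g δ₀ α Λ (fun a => (g.len a ^ 2)⁻¹))
    (hTρ : ScaleTransfer g ρ α' Λρ (fun a => g.len a))
    (hsmall : kappa385 B₀ (cV + cK) κ₁ κ₂ Λ (B6.c1 d δ₀ β) * α₁ * B6.c1 d ρ α' < 1)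
    {G D Ds V₃ V0 V1 P₁ P₂ DsD DsD' Δp Δp' DRDs DRDs' Qs Qs' Q Q' a V₁ V₂ F₂ F₂s : Module.End ℝ (W → ℝ)}
    (hV₃ : V₃ = V0 + V1 * D) (hV₃' : V₃ = B9Eq386Neumann.vThree V₁ V₂ Δp Δp')
    (h371 : DsD' = DsD - V₁) (h376 : DRDs' = DRDs - V₂ - P₁) (h380 : Q' = Q + F₂) (h380s : Qs' = Qs + F₂s)
    (hP₂def : P₂ = pTwo Qs Q F₂ F₂s a)
    (hΔG : B9Eq386Neumann.deltaA DsD Δp DRDs Qs a Q * G = 1) (hGΔ : G * B9Eq386Neumann.deltaA DsD Δp DRDs Qs a Q = 1)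
    (hV0 : HasMajorant (g := toB6 g R H) blk V0
      (fun a b => cV * α₁ * (g.len a ^ 2)⁻¹ * Real.exp (-(δ * g.dist a b))))
    (hV1 : HasMajorant (g := toB6 g R H) blk V1 (fun a b => cV * α₁ * (g.len a)⁻¹ * Real.exp (-(δ * g.dist a b))))
    (hComm : HasMajorant (g := toB6 g R H) blk (V1 * D - D * V1)
      (fun a b => cK * α₁ * (g.len a ^ 2)⁻¹ * Real.exp (-(δ * g.dist a b))))
    (hP₁ : HasMajorant (g := toB6 g R H) blk P₁ (fun a b => κ₁ * α₁ * (g.len a ^ 2)⁻¹ * Real.exp (-(δ * g.dist a b))))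
    (hP₂ : HasMajorant (g := toB6 g R H) blk P₂ (fun a b => κ₂ * α₁ * (g.len a ^ 2)⁻¹ * Real.exp (-(δ * g.dist a b))))
    (hG : HasMajorant (g := toB6 g R H) blk G (fun a b => B₀ * g.len a ^ 2 * Real.exp (-(δ * g.dist a b))))
    (hDG : HasMajorant (g := toB6 g R H) blk (D * G) (fun a b => B₀ * g.len a * Real.exp (-(δ * g.dist a b))))
    (hGD : HasMajorant (g := toB6 g R H) blk (G * D) (fun a b => B₀ * g.len a * Real.exp (-(δ * g.dist a b))))
    (hGDs : HasMajorant (g := toB6 g R H) blk (G * Ds) (fun a b => B₀ * g.len a * Real.exp (-(δ * g.dist a b)))) :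
    ∃ GExt : Module.End ℝ (W → ℝ),
      B9Eq386Neumann.deltaA DsD' Δp' DRDs' Qs' a Q' * GExt = 1 ∧ GExt * B9Eq386Neumann.deltaA DsD' Δp' DRDs' Qs' a Q' = 1 ∧
      HasMajorant (g := toB6 g R H) blk GExt
        (fun a b => B₀ * B6.c1 d ρ α' * (1 - kappa385 B₀ (cV + cK) κ₁ κ₂ Λ (B6.c1 d δ₀ β) * α₁ * B6.c1 d ρ α')⁻¹ *
          g.len a ^ 2 * Real.exp (-((1 - α') * ρ * g.dist a b))) ∧
      HasMajorant (g := toB6 g R H) blk (GExt * Ds)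
        (fun a b => B₀ * Λρ ^ 2 * B6.c1 d ρ α' *
          (1 - kappa385 B₀ (cV + cK) κ₁ κ₂ Λ (B6.c1 d δ₀ β) * α₁ * B6.c1 d ρ α')⁻¹ *
          g.len a * Real.exp (-((1 - 3 * α') * ρ * g.dist a b))) := by
  have hcVK : 0 ≤ cV + cK := add_nonneg hcV hcK
  -- the (3.73) letters at the weakened constant c_V + c_K
  have hV0' : HasMajorant (g := toB6 g R H) blk V0
      (fun a b => (cV + cK) * α₁ * (g.len a ^ 2)⁻¹ * Real.exp (-(δ * g.dist a b))) := by
    refine hasMajorant_mono (g := toB6 g R H) blk hV0 fun a b => ?_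
    have hw : 0 ≤ α₁ * (g.len a ^ 2)⁻¹ * Real.exp (-(δ * g.dist a b)) :=
      mul_nonneg (mul_nonneg hα₁ (inv_nonneg.mpr (sq_nonneg _))) (Real.exp_nonneg _)
    nlinarith
  have hV1' : HasMajorant (g := toB6 g R H) blk V1
      (fun a b => (cV + cK) * α₁ * (g.len a)⁻¹ * Real.exp (-(δ * g.dist a b))) := by
    refine hasMajorant_mono (g := toB6 g R H) blk hV1 fun a b => ?_
    have hw : 0 ≤ α₁ * (g.len a)⁻¹ * Real.exp (-(δ * g.dist a b)) :=
      mul_nonneg (mul_nonneg hα₁ (inv_nonneg.mpr (hlen a).le)) (Real.exp_nonneg _)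
    nlinarith
  -- C₃ := V⁰ + [V¹, ∇] at c_V + c_K
  have hC₃ := hasMajorant_C₃_of_comm (R := R) (H := H) blk δ cV cK α₁ hV0 hComm
  exact thm34_G_entries13_opForm (R := R) (H := H) blk d δ₀ δ α β ρ α' Λ Λρ B₀ (cV + cK) κ₁ κ₂ α₁ hB₀ hcVK hκ₁ hκ₂ hα₁
    hΛ hΛρ hρ hα hβ hδ₀ hr hα' hα'ρ0 hα'ρ2 hdnn htri hrefl hsym hlen h261 h261' hT1 hT2 hT1i hT2i hTρ hsmall hV₃
    (divForm_of_gradForm hV₃) hV₃' h371 h376 h380 h380s hP₂def hΔG hGΔ hV0' hV1' hV1' hC₃ hP₁ hP₂ hG hDG hGD hGDs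

end AssemblyComm

end Literature.MathematicalPhysics.QuantumFieldTheory.Balaban1983to89.B9Ineq386RightEntry
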